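import Literature.MathematicalPhysics.QuantumLattice.HubbardVertexFieldSubstitution
import Literature.Analysis.Matrix.DetDominatedConvergence
import HarnessLib

/-!
# The `M → ∞` limit of the time-integrated Wick determinants of Hubbard vertex fields

Topic `MathematicalPhysics/QuantumLattice`; assembly of `HubbardVertexFieldSubstitution` (the truncated position–time
propagators `g_M` between vertex legs and their bounded convergence), `MatsubaraTruncationMidpoint` (the equal-time
midpoint) and `Literature.Analysis.Matrix.DetDominatedConvergence` (dominated convergence for `∫ det`): for `n`
interaction vertices at fixed sites `x⃗_a` of the torus and any enumeration `P` of (vertex, spin) pairs, the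
time-integrated determinant of truncated propagators — the order-`n` coefficient of the truncated Grassmann perturbation
series (`HubbardVertexWick.gaussExpect_vertexPairWord_eq_det`, BGM 2006 (2.6)–(2.8)) — converges as the frequency
cutoff is removed:

* `timeOrderedPropagator β ξ s` — the scalar free propagator in BGM's convention WITH the midpoint at `s = 0`:
  `(1 − n_F)e^{-ξs}` (`s > 0`), `-n_F e^{-ξs}` (`s < 0`), `½ − n_F` (`s = 0`); `tendsto_truncatedPropagator_bgm_of_abs_lt`
  — `(1/β) Σᵢ e^{-iωᵢs}/(-iωᵢ + ξ) → timeOrderedPropagator β ξ s` for ALL `|s| < β`;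
* `vertexLimitEntry` — the limiting entry `-[σ = σ'] (1/L²) Σ_k⃗ e^{ip·(x⃗_a−x⃗_b)} timeOrderedPropagator β ξ_k⃗ (τ_b − τ_a)`;
  `tendsto_vertexWickEntry`, `continuous_vertexWickEntry`, `norm_vertexWickEntry_le`;
* **`tendsto_integral_cube_det_vertexWick`** —
  `∫_{[0,β]^n} det[-(Sᵀ C_M S)((P i,+),(P j,−))](τ) dτ → ∫_{[0,β]^n} det[vertexLimitEntry …(τ_{(P j).1} − τ_{(P i).1})] dτ`
  (`β > 0`; convergence holds at every `τ` of the open cube — the midpoint value takes care of coinciding times — and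
  the faces `{τ_a ∈ {0, β}}` are null).

The identification of the limit with the Hamiltonian-side `propMatrix` determinants (`ShiftedHubbardDysonDeterminant`,
`MatsubaraResolventKernelLimit`), the bookkeeping `𝔼[V^k] = U^k Σ_x⃗ ∫ …` and the sum over orders are NOT here.

## Sources

G. Benfatto, A. Giuliani, V. Mastropietro, Ann. Henri Poincaré 7 (2006) 809–898, §2.1 (2.3)–(2.8)
[`BenfattoGiulianiMastropietro2006`]. [folklore]
-/

noncomputable section

namespace Literature.MathematicalPhysics.QuantumLattice

open Finset Filter _root_.MeasureTheory Literature.Probability.LatticeModels _root_.Topology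
open scoped ComplexConjugate

/-! ### The scalar time-ordered propagator with its midpoint, as a Matsubara limit for all `|s| < β` -/

/-- The **scalar free imaginary-time propagator** in BGM's convention `ĝ = 1/(-ik₀ + ξ)`, as a function of the time
difference `s ∈ (-β, β)`, with the MIDPOINT value at `s = 0` (the value selected by the symmetric frequency
truncation, `MatsubaraTruncationMidpoint`): `(1 − n_F(ξ))e^{-ξs}` for `s > 0`, `-n_F(ξ)e^{-ξs}` for `s < 0`,
`½ − n_F(ξ)` for `s = 0` (`n_F(ξ) = (1 + e^{βξ})⁻¹`). [cite: BenfattoGiulianiMastropietro2006, §2.1 (2.3)-(2.4)] -/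
def timeOrderedPropagator (β ξ s : ℝ) : ℝ :=
  if 0 < s then (1 + Real.exp (-(β * ξ)))⁻¹ * Real.exp (-(ξ * s))
  else if s < 0 then -((1 + Real.exp (β * ξ))⁻¹ * Real.exp (-(ξ * s)))
  else 1 / 2 - (1 + Real.exp (β * ξ))⁻¹

/-- `|timeOrderedPropagator β ξ s| ≤ e^{β|ξ|}` crudely; we only need: it is bounded by `1 · e^{|ξ||s|}`-type
quantities.  Here the elementary bound `‖·‖ ≤ Real.exp (|ξ| * |s|)`. [folklore] -/
theorem abs_timeOrderedPropagator_le (β ξ s : ℝ) : |timeOrderedPropagator β ξ s| ≤ Real.exp (|ξ| * |s|) := by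
  have hf1 : (1 + Real.exp (-(β * ξ)))⁻¹ ≤ 1 := inv_le_one_of_one_le₀ (by linarith [Real.exp_pos (-(β * ξ))])
  have hf2 : (1 + Real.exp (β * ξ))⁻¹ ≤ 1 := inv_le_one_of_one_le₀ (by linarith [Real.exp_pos (β * ξ)])
  have hf1' : 0 ≤ (1 + Real.exp (-(β * ξ)))⁻¹ := by positivity
  have hf2' : 0 ≤ (1 + Real.exp (β * ξ))⁻¹ := by positivity
  have hexp : Real.exp (-(ξ * s)) ≤ Real.exp (|ξ| * |s|) := by
    apply Real.exp_le_exp.2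
    calc -(ξ * s) ≤ |ξ * s| := neg_le_abs _
      _ = |ξ| * |s| := abs_mul ξ s
  unfold timeOrderedPropagator
  split_ifs with h1 h2
  · rw [abs_of_nonneg (by positivity)]
    calc _ ≤ 1 * Real.exp (-(ξ * s)) := by gcongr
      _ ≤ _ := by rw [one_mul]; exact hexp
  · rw [abs_neg, abs_of_nonneg (by positivity)]
    calc _ ≤ 1 * Real.exp (-(ξ * s)) := by gcongr
      _ ≤ _ := by rw [one_mul]; exact hexp
  · have hs : s = 0 := le_antisymm (not_lt.1 h1) (not_lt.1 h2)
    subst hs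
    rw [abs_zero, mul_zero, Real.exp_zero, abs_le]
    constructor <;> nlinarith

/-- **The truncated Matsubara representation converges to the time-ordered propagator for every `|s| < β`**
(`0 < s`: `tendsto_truncatedPropagator_bgm_of_mem_Ioo`; `s < 0`: `…_neg`; `s = 0`: the midpoint
`tendsto_truncatedTadpole_bgm`). [cite: BenfattoGiulianiMastropietro2006, §2.1 (2.3)-(2.4)] -/
theorem tendsto_truncatedPropagator_bgm_of_abs_lt {β : ℝ} (hβ : 0 < β) (ξ : ℝ) {s : ℝ} (hs : |s| < β) :
    Tendsto (fun M : ℕ => (1 / (β : ℂ)) * ∑ i : MatsubaraIdx M, Complex.exp (-(Complex.I * matsubaraFreq β M i * s)) *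
        (1 / (-(Complex.I * matsubaraFreq β M i) + ξ))) atTop (𝓝 ((timeOrderedPropagator β ξ s : ℝ) : ℂ)) := by
  rw [abs_lt] at hs
  rcases lt_trichotomy s 0 with h | h | h
  · have hval : timeOrderedPropagator β ξ s = -((1 + Real.exp (β * ξ))⁻¹ * Real.exp (-(ξ * s))) := by
      rw [timeOrderedPropagator, if_neg (not_lt.2 h.le), if_pos h]
    rw [hval]
    exact tendsto_truncatedPropagator_bgm_of_mem_Ioo_neg hβ ξ ⟨hs.1, h⟩
  · subst h
    have hval : timeOrderedPropagator β ξ 0 = 1 / 2 - (1 + Real.exp (β * ξ))⁻¹ := by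
      rw [timeOrderedPropagator, if_neg (lt_irrefl 0), if_neg (lt_irrefl 0)]
    rw [hval]
    refine (tendsto_truncatedTadpole_bgm hβ ξ).congr fun M => ?_
    refine congrArg _ (sum_congr rfl fun i _ => ?_)
    rw [Complex.ofReal_zero, mul_zero, neg_zero, Complex.exp_zero, one_mul]
  · have hval : timeOrderedPropagator β ξ s = (1 + Real.exp (-(β * ξ)))⁻¹ * Real.exp (-(ξ * s)) := by
      rw [timeOrderedPropagator, if_pos h]
    rw [hval]
    exact tendsto_truncatedPropagator_bgm_of_mem_Ioo hβ ξ ⟨h, hs.2⟩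

/-! ### The limiting entries -/

variable (L : ℕ) [NeZero L]

/-- **The limiting Wick entry** between a `ψ⁺` leg of spin `σ` at site `x⃗_a` and a `ψ⁻` leg of spin `σ'` at `x⃗_b`,
as a function of the time difference `s = τ_b − τ_a`:
`-[σ = σ'] (1/L²) Σ_k⃗ e^{ip·(x⃗_a−x⃗_b)} timeOrderedPropagator β ξ_k⃗ s` (minus the free position–time propagator
`g(x_b − x_a)` of BGM (2.4), midpoint at equal times). [cite: BenfattoGiulianiMastropietro2006, §2.1 (2.4)] -/
def vertexLimitEntry (β μ : ℝ) (xa xb : TorusSite 2 L) (σ σ' : Fin 2) (s : ℝ) : ℂ :=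
  -(if σ = σ' then ((1 / (L : ℝ) ^ 2 : ℝ) : ℂ) * ∑ q : TorusSite 2 L,
    Complex.exp (((∑ j, latticeMomentum L q j * (((xa j).val : ℝ) - ((xb j).val : ℝ)) : ℝ) : ℂ) * Complex.I) *
      ((timeOrderedPropagator β (nambuXi L μ q) s : ℝ) : ℂ) else 0)

variable {L}

/-- **Entrywise convergence**: for `|τ_b − τ_a| < β` the Wick entry `-(Sᵀ C_M S)((a,σ,+),(b,σ',−))` converges to
`vertexLimitEntry … (τ_b − τ_a)` as `M → ∞` (`β > 0`). [cite: BenfattoGiulianiMastropietro2006, §2.1 (2.3)-(2.4)] -/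
theorem tendsto_vertexWickEntry {β : ℝ} (hβ : 0 < β) (μ : ℝ) {n : ℕ} (x : Fin n → TorusSite 2 L) (τ : Fin n → ℝ)
    (a b : Fin n) (σ σ' : Fin 2) (hs : |τ b - τ a| < β) :
    Tendsto (fun M : ℕ => -((vertexSubMatrix L M β x τ).transpose * hubbardCovariance L M β μ 0 *
        vertexSubMatrix L M β x τ) ((a, σ), 0) ((b, σ'), 1)) atTop
      (𝓝 (vertexLimitEntry L β μ (x a) (x b) σ σ' (τ b - τ a))) := by
  simp only [vertexSub_pullback_zero_seed_apply_zero_one hβ.ne', vertexLimitEntry]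
  refine Tendsto.neg ?_
  split_ifs with hσ
  · exact (tendsto_finsetSum _ fun q _ =>
      (tendsto_truncatedPropagator_bgm_of_abs_lt hβ (nambuXi L μ q) hs).const_mul _).const_mul _
  · exact tendsto_const_nhds

/-- The Wick entries are continuous functions of the vertex times (finite sums of exponentials; `β ≠ 0`). [folklore] -/
theorem continuous_vertexWickEntry {β : ℝ} (hβ : β ≠ 0) (μ : ℝ) {n : ℕ} (x : Fin n → TorusSite 2 L) (M : ℕ)
    (a b : Fin n) (σ σ' : Fin 2) :
    Continuous fun τ : Fin n → ℝ => -((vertexSubMatrix L M β x τ).transpose * hubbardCovariance L M β μ 0 *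
        vertexSubMatrix L M β x τ) ((a, σ), 0) ((b, σ'), 1) := by
  simp only [vertexSub_pullback_zero_seed_apply_zero_one hβ]
  refine Continuous.neg ?_
  split_ifs with hσ
  · refine continuous_const.mul (continuous_finsetSum _ fun q _ => continuous_const.mul
      (continuous_const.mul (continuous_finsetSum _ fun i _ => Continuous.mul ?_ continuous_const)))
    refine Complex.continuous_exp.comp (Continuous.neg (continuous_const.mul ?_))
    exact Complex.continuous_ofReal.comp ((continuous_apply b).sub (continuous_apply a))
  · exact continuous_const

/-- Uniform bound on the Wick entries: `‖-(Sᵀ C_M S)((a,σ,+),(b,σ',−))‖ ≤ (1/L²) Σ_k⃗ (2 + β|ξ_k⃗|/3)` (all `M`, `τ`).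
[folklore] -/
theorem norm_vertexWickEntry_le {β : ℝ} (hβ : 0 < β) (μ : ℝ) {n : ℕ} (x : Fin n → TorusSite 2 L) (τ : Fin n → ℝ)
    (M : ℕ) (a b : Fin n) (σ σ' : Fin 2) :
    ‖-((vertexSubMatrix L M β x τ).transpose * hubbardCovariance L M β μ 0 * vertexSubMatrix L M β x τ)
        ((a, σ), 0) ((b, σ'), 1)‖ ≤ (1 / (L : ℝ) ^ 2) * ∑ q : TorusSite 2 L, (2 + β * |nambuXi L μ q| / 3) := by
  rw [norm_neg]
  exact norm_vertexSub_pullback_zero_seed_zero_one_le hβ μ x τ a b σ σ' M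

/-! ### The faces of the time cube are null -/

omit [NeZero L] in
/-- The union of the faces `{τ_a = 0}` and `{τ_a = β}` of the time cube is null. [folklore] -/
theorem volume_setOf_exists_apply_mem_pair {k : ℕ} (β : ℝ) :
    volume {t : Fin k → ℝ | ∃ a, t a = 0 ∨ t a = β} = 0 := by
  have hsub : {t : Fin k → ℝ | ∃ a, t a = 0 ∨ t a = β} ⊆
      ⋃ a : Fin k, ({t : Fin k → ℝ | t a = 0} ∪ {t : Fin k → ℝ | t a = β}) := by
    intro t ht
    obtain ⟨a, h⟩ := ht
    exact Set.mem_iUnion.2 ⟨a, h⟩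
  -- each coordinate hyperplane `{t a = c}` is null: translate of the strict subspace `{t a = 0}`
  -- (cf. `Literature.Analysis.SpecialFunctions.Selberg.volume_setOf_apply_eq` for `{t p = t q}`)
  have hplane : ∀ (a : Fin k) (c : ℝ), volume {t : Fin k → ℝ | t a = c} = 0 := by
    intro a c
    have h0 : volume {t : Fin k → ℝ | t a = 0} = 0 := by
      let f : (Fin k → ℝ) →ₗ[ℝ] ℝ := LinearMap.proj (R := ℝ) (φ := fun _ : Fin k => ℝ) a
      have hker : {t : Fin k → ℝ | t a = 0} = (LinearMap.ker f : Set (Fin k → ℝ)) := by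
        ext t; simp [f]
      have hne : LinearMap.ker f ≠ ⊤ := by
        intro htop
        have hmem : (Pi.single a (1 : ℝ) : Fin k → ℝ) ∈ LinearMap.ker f := by rw [htop]; exact Submodule.mem_top
        simp [f] at hmem
      rw [hker]
      exact Measure.addHaar_submodule volume _ hne
    have hpre : {t : Fin k → ℝ | t a = c} = (fun t => t + (-(c • (Pi.single a (1 : ℝ) : Fin k → ℝ)))) ⁻¹'
        {t : Fin k → ℝ | t a = 0} := by
      ext t
      simp only [Set.mem_setOf_eq, Set.mem_preimage, Pi.add_apply, Pi.neg_apply, Pi.smul_apply, Pi.single_eq_same,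
        smul_eq_mul, mul_one, add_neg_eq_zero]
    rw [hpre, measure_preimage_add_right, h0]
  refine measure_mono_null hsub ?_
  rw [measure_iUnion_null_iff]
  intro a
  exact measure_union_null (hplane a 0) (hplane a β)

/-! ### The limit of the time-integrated Wick determinants -/

/-- **The `M → ∞` limit of the order-`n` coefficient**: for `β > 0`, fixed vertex sites `x⃗` and any pair enumeration
`P`, the integral over the time cube `[0, β]^n` of the Wick determinant of truncated propagators converges to the
integral of the determinant of the limiting entries (free imaginary-time propagators with the midpoint at equal
times).  Entries converge at every point of the open cube (`|τ_b − τ_a| < β`), are continuous and uniformly bounded;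
the faces are null; `Literature.Analysis.Matrix.tendsto_setIntegral_det`.
[cite: BenfattoGiulianiMastropietro2006, §2.1 (2.6)-(2.8)] -/
theorem tendsto_integral_cube_det_vertexWick {β : ℝ} (hβ : 0 < β) (μ : ℝ) {n m : ℕ} (x : Fin n → TorusSite 2 L)
    (P : Fin m → Fin n × Fin 2) :
    Tendsto (fun M : ℕ => ∫ τ in Set.Icc (0 : Fin n → ℝ) (fun _ => β),
        (Matrix.of fun i j => -((vertexSubMatrix L M β x τ).transpose * hubbardCovariance L M β μ 0 *
          vertexSubMatrix L M β x τ) (((P i), 0) : VertexLeg n) (((P j), 1) : VertexLeg n)).det) atTop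
      (𝓝 (∫ τ in Set.Icc (0 : Fin n → ℝ) (fun _ => β),
        (Matrix.of fun i j => vertexLimitEntry L β μ (x (P i).1) (x (P j).1) (P i).2 (P j).2 (τ (P j).1 - τ (P i).1)).det)) := by
  refine Literature.Analysis.Matrix.tendsto_setIntegral_det (Literature.Analysis.Matrix.volume_Icc_cube_ne_top β)
    measurableSet_Icc (volume_setOf_exists_apply_mem_pair β) (fun M i j => ?_)
    (B := (1 / (L : ℝ) ^ 2) * ∑ q : TorusSite 2 L, (2 + β * |nambuXi L μ q| / 3)) (fun M τ _ i j => ?_)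
    fun τ hτ hτS i j => ?_
  · simp only [Matrix.of_apply]
    obtain ⟨a, σ⟩ := P i
    obtain ⟨b, σ'⟩ := P j
    exact continuous_vertexWickEntry hβ.ne' μ x M a b σ σ'
  · simp only [Matrix.of_apply]
    obtain ⟨a, σ⟩ := P i
    obtain ⟨b, σ'⟩ := P j
    exact norm_vertexWickEntry_le hβ μ x τ M a b σ σ'
  · simp only [Matrix.of_apply]
    -- interior point: every `τ c ∈ (0, β)`
    have hint : ∀ c, 0 < τ c ∧ τ c < β := by
      intro c
      have h1 : 0 ≤ τ c := hτ.1 c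
      have h2 : τ c ≤ β := hτ.2 c
      refine ⟨lt_of_le_of_ne h1 fun h => hτS ⟨c, Or.inl h.symm⟩, lt_of_le_of_ne h2 fun h => hτS ⟨c, Or.inr h⟩⟩
    obtain ⟨a, σ⟩ := P i
    obtain ⟨b, σ'⟩ := P j
    have hs : |τ b - τ a| < β := by
      rw [abs_lt]
      constructor <;> linarith [(hint a).1, (hint a).2, (hint b).1, (hint b).2]
    exact tendsto_vertexWickEntry hβ μ x τ a b σ σ' hs

end Literature.MathematicalPhysics.QuantumLattice
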